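import Literature.NumberTheory.GaloisRepresentations.ContinuousShapiroLiftUnit
import Literature.NumberTheory.GaloisRepresentations.BrauerTower
import HarnessLib

/-!
# Shapiro lifts with a PRESCRIBED restriction along `θ : D → G`: if `θ^*(Sh_N c) = H¹(u_θ) a'` then EVERY conjugate of the
# layer class restricts to `a'` — `θ_N^*(γ · c) = res_{θ⁻¹N} a'` for all `γ ∈ G`

Generic continuous group cohomology (no number theory); namespace `Literature.NumberTheory.GaloisRepresentations`. THEOREMS ONLY
(no definition, no named fact, no instance, no notation, no `sorry`). Sequel of `ContinuousShapiroLiftUnit.lean` (§2 there: every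
Mackey component of the push-forward `H¹(u_θ) a'` of a LOCAL class along a unit is `Sh^D(res a')`) and of
`ContinuousShapiroLiftMackeyCup.lean` §3 (`map_resCoindFinHomR_shapiroLift`: the Mackey component of `θ^*(Sh_N c)` at the double coset of
`γ` is `Sh^D(θ_N^*(γ · c))`).

* `map_comapSubtypeHom_conjMap_eq_resSubgroup_of_map_shapiroLift_eq` — for `θ : D →ₜ* G`, `N ⊴ G` open normal of finite index,
  `c ∈ H¹(N, X)`, a LOCAL class `a' ∈ H¹(D, X|_θ)`, a unit `u_θ` over `D` and an identity-like `j` writing the restriction `θ^*`: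
  `H¹(θ, j)(Sh_N c) = H¹(u_θ) a'  ⟹  ∀ γ, H¹(θ_N; id)(γ · c) = res^D_{θ⁻¹N} a'`
  (apply the Mackey projection `Φ_{γN}`, compare the two component formulas, Shapiro injectivity).

Consumer (why). In the Poitou–Tate call of the H46 kernel programme (cell `bsd-2adic`, item stmt-BirchSwinnertonDyer-19271; road C′,
brick B5 §3) the output class at the auxiliary place `v₀` has `loc_{v₀}(Sh c) = H¹(u) z̃`; this lemma turns it into «every conjugate
`σ · c` restricts on `Γ_n ∩ D_{v₀}` to `res z̃`», the layer form of clause (iii) of Greenberg's Lemma 4.6 on `Γ`-invariants. HONEST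
FRAMING: bookkeeping only.

## References
* K. S. Brown, *Cohomology of Groups* (1982), III §5 (5.6)(b). [Brown1982]
* J. Neukirch, A. Schmidt, K. Wingberg, *Cohomology of Number Fields*, 2nd ed. (2008), I §5 (1.5.6)–(1.5.7), I §6 (1.6.4). [NeukirchSchmidtWingberg2008]
-/

noncomputable section

open CategoryTheory

universe u v

namespace Literature.NumberTheory.GaloisRepresentations

open _root_.TopRep _root_.ContinuousCohomology

variable {R : Type u} [CommRing R] [TopologicalSpace R]
variable {G : Type v} [Group G] [TopologicalSpace G] [IsTopologicalGroup G]
variable {D : Type v} [Group D] [TopologicalSpace D] [IsTopologicalGroup D]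
variable (X : TopRep.{v} R G) (N : Subgroup G) [N.Normal] (θ : D →ₜ* G) (hN : IsOpen (N : Set G))
  {s : G ⧸ N → G} (hs : ∀ y : G ⧸ N, (s y : G ⧸ N) = y) (hs1 : s ((1 : G) : G ⧸ N) = 1)

/-- **Prescribed unit restriction ⟹ every conjugate restricts to the prescribed class.** Let `θ : D →ₜ* G`, `N ⊴ G` open normal of
finite index, `c ∈ H¹(N, X)`, `a' ∈ H¹(D, X|_θ)`, `u_θ : X|_θ ⟶ Maps(G ⧸ N, X)|_θ` a unit (`(u_θ x)(y) = x`) and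
`j : Maps(G ⧸ N, X)|_θ ⟶ Maps(G ⧸ N, X)|_θ` identity-like (`j ψ = ψ`; the coefficient morphism of the restriction `θ^*`). If
`H¹(θ, j)(Sh_N c) = H¹(u_θ) a'`, then for every `γ ∈ G`: `H¹(θ_N; id)(γ · c) = res^D_{θ⁻¹N} a'`, where `γ · c = conjMap X N γ 1 c`,
`θ_N = comapSubtypeHom N θ : θ⁻¹N → N` and `res^D_{θ⁻¹N} = resSubgroup (X|_θ) (θ⁻¹N) 1`. [cite: Brown1982, III §5 (5.6)(b)]
[cite: NeukirchSchmidtWingberg2008, I §6 Prop. (1.6.4)] -/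
theorem map_comapSubtypeHom_conjMap_eq_resSubgroup_of_map_shapiroLift_eq [Fintype (G ⧸ N)]
    (uθ : TopRep.res (θ : D →* G) X ⟶ TopRep.res (θ : D →* G) (coindFin X N))
    (hu : ∀ (x : X) (y : G ⧸ N), (uθ.hom x : G ⧸ N → X) y = x)
    (j : TopRep.res (θ : D →* G) (coindFin X N) ⟶ TopRep.res (θ : D →* G) (coindFin X N)) (hj : ∀ ψ, j.hom ψ = ψ)
    (c : continuousCohomology 1 (subgroupRep X N)) (a' : continuousCohomology 1 (TopRep.res (θ : D →* G) X))
    (h : ContinuousCohomology.map θ j 1 (shapiroLift X N hN hs hs1 c) = cohomologyMap uθ 1 a') (γ : G) :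
    ContinuousCohomology.map (comapSubtypeHom N θ) (comapCoeffHom X N θ) 1 (conjMap X N γ 1 c) =
      resSubgroup (TopRep.res (θ : D →* G) X) (N.comap (θ : D →* G)) 1 a' := by
  obtain ⟨sD, hsD, hsD1⟩ := exists_reps_one (N.comap (θ : D →* G))
  -- apply the Mackey projection `Φ_{γN}` to both sides of `h`
  have hc := congrArg (cohomologyMap (resCoindFinHomR X N θ (γ : G ⧸ N)) 1) h
  -- left: `Φ_{γN} ∘ (θ, j) = (θ, Φ_{γN})`, then the component of a Shapiro lift
  have hl : cohomologyMap (resCoindFinHomR X N θ (γ : G ⧸ N)) 1 (ContinuousCohomology.map θ j 1 (shapiroLift X N hN hs hs1 c)) =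
      ContinuousCohomology.map θ (resCoindFinHomR X N θ (γ : G ⧸ N)) 1 (shapiroLift X N hN hs hs1 c) :=
    (map_comp_apply_of θ (ContinuousMonoidHom.id D) θ (fun _ => rfl) j (resIdHom (resCoindFinHomR X N θ (γ : G ⧸ N)))
      (resCoindFinHomR X N θ (γ : G ⧸ N)) (fun ψ => by
        change (resCoindFinHomR X N θ (γ : G ⧸ N)).hom ψ = (resCoindFinHomR X N θ (γ : G ⧸ N)).hom (j.hom ψ)
        rw [hj]) 1 _).symm
  rw [hl, map_resCoindFinHomR_shapiroLift X N θ hN hs hs1 hsD hsD1 γ c,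
    cohomologyMap_resCoindFinHomR_cohomologyMap_of_const X N θ hN hsD hsD1 uθ hu (γ : G ⧸ N) a'] at hc
  exact shapiroLift_injective (TopRep.res (θ : D →* G) X) (N.comap (θ : D →* G)) (isOpen_comap N θ hN) hsD hsD1 hc

end Literature.NumberTheory.GaloisRepresentations

end
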